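import Summits.Parity.BatemanHorn.Theses.IsogenyRedei

/-!
# `SplitBlockJacobiCorner` (crux stmt-Parity-15002): the hypothesis `μ < 2 − 2θ` is redundant

Negative-side load-bearing analysis (cdisprove seat refuter-cdisprove-stmt-Parity-15002-0, cycle 1), sorry-free and
without new definitions.  The crux reads `∃ δ > 0, ∀ θ μ, 1/2 < θ → 1 − δ ≤ μ → μ < 2 − 2θ → J^c_{θ,μ} = o(x)` with
`J^c_{θ,μ}(x) = Σ_{t ≤ x} Σ_{(Q,Q') ∈ pf(t²+1)², x^θ < Q < Q', QQ' ≤ x^{2−μ}} (Q|Q')`.  We prove that for `μ ≥ 2 − 2θ`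
(any `θ > 0`) the inner pair set is EMPTY for every `x, t` — `x^θ < Q < Q'` forces `QQ' > x^{2θ} ≥ x^{2−μ}` —
so the corner sum vanishes identically there (`cornerFilter_eq_empty`, `cornerSum_eq_zero`), and hence the crux is
EQUIVALENT to the same statement with the hypothesis `μ < 2 − 2θ` deleted (`splitBlockJacobiCorner_iff_dropMuUpper`).
Reading for provers/planners: the upper cut on `μ` only records where the corner is non-empty; no proof of the crux
can use it, and a refutation may ignore it.  (Companion facts in the seat's `Cruxes/SplitBlockJacobiCorner/Disproof.lean`:
dropping `1 − δ ≤ μ` instead gives a statement at least as strong as the co-rank-2 crux `SplitBlockJacobi`; dropping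
`1/2 < θ` is numerically false at `θ = 0`.)
-/

namespace Summit.Parity.BatemanHorn.Theorems.SplitBlockJacobiCorner.Negative

open Finset Filter Asymptotics
open Summit.Parity.BatemanHorn.Theses.IsogenyRedei (SplitBlockJacobiCorner)

/-- Size bookkeeping of the corner: `x^θ < Q < Q'` with `0 < θ` gives `x^{2θ} < QQ'`. [folklore] -/
theorem rpow_two_mul_lt_mul {θ : ℝ} (hθ : 0 < θ) {x Q Q' : ℕ} (h1 : (x : ℝ) ^ θ < Q) (h2 : Q < Q') :
    (x : ℝ) ^ (2 * θ) < ((Q * Q' : ℕ) : ℝ) := by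
  have hx0 : (0 : ℝ) ≤ x := Nat.cast_nonneg x
  have hpow0 : (0 : ℝ) ≤ (x : ℝ) ^ θ := Real.rpow_nonneg hx0 θ
  have hQpos : (0 : ℝ) < Q := hpow0.trans_lt h1
  have hQQ' : (Q : ℝ) < Q' := by exact_mod_cast h2
  have hsq : (x : ℝ) ^ (2 * θ) = (x : ℝ) ^ θ * (x : ℝ) ^ θ := by
    rw [two_mul, Real.rpow_add' hx0 (by linarith)]
  rw [hsq]
  push_cast
  calc (x : ℝ) ^ θ * (x : ℝ) ^ θ ≤ (Q : ℝ) * (x : ℝ) ^ θ := by gcongr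
    _ < Q * Q' := by gcongr; exact h1.trans hQQ'

/-- **Empty corner beyond the cut.** For `0 < θ` and `2 − 2θ ≤ μ`, the crux's pair filter selects NOTHING from
`pf(t²+1) × pf(t²+1)`, for every `x` and `t` (at `x = 0` the cut reads `QQ' ≤ 0^{2−μ} ≤ 1 < 2 ≤ QQ'`). [folklore] -/
theorem cornerFilter_eq_empty {θ μ : ℝ} (hθ : 0 < θ) (hμ : 2 - 2 * θ ≤ μ) (x t : ℕ) :
    ((t ^ 2 + 1).primeFactors ×ˢ (t ^ 2 + 1).primeFactors).filter
        (fun q : ℕ × ℕ => (x : ℝ) ^ θ < (q.1 : ℝ) ∧ q.1 < q.2 ∧ ((q.1 * q.2 : ℕ) : ℝ) ≤ (x : ℝ) ^ (2 - μ)) = ∅ := by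
  refine Finset.eq_empty_of_forall_notMem ?_
  intro q hq
  rw [Finset.mem_filter] at hq
  obtain ⟨-, h1, h2, h3⟩ := hq
  have hlt := rpow_two_mul_lt_mul hθ h1 h2
  rcases Nat.eq_zero_or_pos x with rfl | hx
  · have h0 : ((0 : ℕ) : ℝ) = 0 := Nat.cast_zero
    rw [h0] at h1 h3
    have hQ1 : 0 < q.1 := by
      have : (0 : ℝ) < q.1 := (Real.rpow_nonneg le_rfl θ).trans_lt h1
      exact_mod_cast this
    have hprod : 2 ≤ q.1 * q.2 := by nlinarith [h2, hQ1]
    have hprodR : (2 : ℝ) ≤ ((q.1 * q.2 : ℕ) : ℝ) := by exact_mod_cast hprod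
    have h01 : (0 : ℝ) ^ (2 - μ) ≤ 1 := Real.zero_rpow_le_one _
    linarith
  · have hx1 : (1 : ℝ) ≤ x := by exact_mod_cast hx
    have hle : (x : ℝ) ^ (2 - μ) ≤ (x : ℝ) ^ (2 * θ) :=
      Real.rpow_le_rpow_of_exponent_le hx1 (by linarith)
    linarith

/-- **The corner sum vanishes identically beyond the cut** (`0 < θ`, `2 − 2θ ≤ μ`, every `x`). [folklore] -/
theorem cornerSum_eq_zero {θ μ : ℝ} (hθ : 0 < θ) (hμ : 2 - 2 * θ ≤ μ) (x : ℕ) :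
    (∑ t ∈ Finset.Icc 1 x, ∑ q ∈ ((t ^ 2 + 1).primeFactors ×ˢ (t ^ 2 + 1).primeFactors).filter
        (fun q : ℕ × ℕ => (x : ℝ) ^ θ < (q.1 : ℝ) ∧ q.1 < q.2 ∧ ((q.1 * q.2 : ℕ) : ℝ) ≤ (x : ℝ) ^ (2 - μ)),
        (jacobiSym (q.1 : ℤ) q.2 : ℝ)) = 0 := by
  refine Finset.sum_eq_zero fun t _ => ?_
  rw [cornerFilter_eq_empty hθ hμ, Finset.sum_empty]

/-- **`SplitBlockJacobiCorner` ↔ the same statement WITHOUT the hypothesis `μ < 2 − 2θ`.**  The extra cases of the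
right-hand side are identically-zero functions (`cornerSum_eq_zero`, using only `θ > 1/2 > 0`), hence `o(x)`.
So the hypothesis is not load-bearing: information for the prover (never needed) and for any refuter (may be
ignored). [folklore] -/
theorem splitBlockJacobiCorner_iff_dropMuUpper :
    SplitBlockJacobiCorner ↔
      ∃ δ : ℝ, 0 < δ ∧ ∀ θ μ : ℝ, 1 / 2 < θ → 1 - δ ≤ μ →
        (fun x : ℕ => ∑ t ∈ Finset.Icc 1 x, ∑ q ∈ ((t ^ 2 + 1).primeFactors ×ˢ (t ^ 2 + 1).primeFactors).filter
            (fun q : ℕ × ℕ => (x : ℝ) ^ θ < (q.1 : ℝ) ∧ q.1 < q.2 ∧ ((q.1 * q.2 : ℕ) : ℝ) ≤ (x : ℝ) ^ (2 - μ)),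
            (jacobiSym (q.1 : ℤ) q.2 : ℝ)) =o[atTop] fun x : ℕ => (x : ℝ) := by
  constructor
  · rintro ⟨δ, hδ, h⟩
    refine ⟨δ, hδ, fun θ μ hθ hμ => ?_⟩
    by_cases hup : μ < 2 - 2 * θ
    · exact h θ μ hθ hμ hup
    · have hz : (fun x : ℕ => ∑ t ∈ Finset.Icc 1 x,
          ∑ q ∈ ((t ^ 2 + 1).primeFactors ×ˢ (t ^ 2 + 1).primeFactors).filter
            (fun q : ℕ × ℕ => (x : ℝ) ^ θ < (q.1 : ℝ) ∧ q.1 < q.2 ∧ ((q.1 * q.2 : ℕ) : ℝ) ≤ (x : ℝ) ^ (2 - μ)),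
            (jacobiSym (q.1 : ℤ) q.2 : ℝ)) = fun _ => (0 : ℝ) :=
        funext fun x => cornerSum_eq_zero (by linarith) (by linarith) x
      rw [hz]
      exact Asymptotics.isLittleO_zero _ _
  · rintro ⟨δ, hδ, h⟩
    exact ⟨δ, hδ, fun θ μ hθ hμ _ => h θ μ hθ hμ⟩

end Summit.Parity.BatemanHorn.Theorems.SplitBlockJacobiCorner.Negative
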